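import Summits.BirchSwinnertonDyer.Rank1Residual.SmallImageMu.MuDefectLeFineMuEdges
import Summits.BirchSwinnertonDyer.BirchSwinnertonDyer.Theorems.SmallImageMuTransferMuTransferOfFine
import Summits.BirchSwinnertonDyer.BirchSwinnertonDyer.Theses.SmallImageMuTransfer
import Summits.BirchSwinnertonDyer.BirchSwinnertonDyer.Theses.OneSidedTwistSqueezeX9
import Literature.NumberTheory.EllipticCurves.IwasawaAlgebraMuQuotientProofs
import Literature.NumberTheory.EllipticCurves.Kato2004.DivisibilityInputsZetaLine
import HarnessLib

set_option autoImplicit false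

-- the summit and its single problem are both named `BirchSwinnertonDyer` (registry layout D-0017)
set_option linter.dupNamespace false

/-!
# Crux `KatoDivisibilityX9` (stmt-BirchSwinnertonDyer-20547) ⟸ crux `AnalyticMuZeroX9`
# (stmt-BirchSwinnertonDyer-19630) modulo F1 ALONE — no modularity binder, no BCS 2025

Cell `bsd-f3-mu`, ES lens (planner-bsd-f3-mu-es g13): the director's W-58 (iv) target
(2026-08-27T22:57:12Z) in its typed shape
`katoDivisibilityX9_of_analyticMuZeroX9_of_fine : F1 → AnalyticMuZeroX9 → KatoDivisibilityX9` with
F1 = `Kato2004.exists_divisibilityInputs_fineQuotient_zeta` the single published construction fact of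
item 19629's closure (`Theorems.smallImageMuTransfer_MuTransfer_of_fine`, p482919).  Companion of
`Theorems/OneSidedTwistSqueezeX9KatoDivisibilityX9OfAnalyticMuZeroX9.lean` (the ES road modulo
modularity + F1 and the K6 road modulo BCS (a) + F1); here BOTH extra binders are gone.

The road, per pair and CLASS-FREE (every `p ≥ 5` good ordinary pair with `E[p]` irreducible — X9, X10b and
the surjective cell alike): the goal `KatoDivisibilityAt W p` quantifies over the newforms `f` of `W`, so
the newform is taken FROM THE GOAL (no modular-parametrisation supply); `μ^an(f) = 0` and the `μ`-transfer
modulo F1 (item 19629) give `μ(X(E/ℚ_∞)) = 0` (`MuAlgZeroAt`); the **quotient edge**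
`fineMuZeroAt_of_muAlgZeroAt_of_fine` — F1's own SURJECTION `π : X(E/ℚ_∞) ↠ X₀(E/ℚ_∞)` (the dual of
`Sel₀ ⊆ Sel`, Kato (14.9.3)/(17.13.1)) and `μ` monotone along surjections of finitely generated torsion
`Λ`-modules (`muInvariant_le_of_surjective`; `X` torsion by Kato 17.4 (1) read off the package,
`Theorems.smallImageMuTransfer_kato_divisibility_of_fine`) — gives `μ(X₀(E/ℚ_∞)) = 0` (`FineMuZeroAt`);
and the landed BCS-free closer `SmallImageMu.katoDivisibilityAt_of_fineMuZeroAt_F1` (Kato §17.13 at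
`𝔭 = (p)` with GV Prop. 3.7) puts `G₁`, `ι G₁ = L_p(f, α)`, in `ch_Λ X`.  Tree imports only; no new named
fact; nothing asserted; 0 sorry.

§4 ports everything to the print cell's VERBATIM-COMPOSITE restatement F1′ =
`Kato2004.exists_divisibilityInputsZetaLine_fineQuotient_zeta` (p539168: the Irr-only localisation clause of F1
re-proved as a theorem from two print-verbatim fields, Kato Thm. 12.6 / 16.6 (2) / 17.5 and Prop. 17.11) by the
landed port `exists_divisibilityInputs_fineQuotient_zeta_of_zetaLine : F1′ → F1` — one term each (ref2 g15
placement (c), 2026-08-27T23:11:33Z).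

Ledger reading: 20547 ⟸ 19630 ∧ F1 (equally ⟸ 19630 ∧ F1′) as ONE kernel theorem; with `Theorems.smallImageMuTransfer_MuTransfer_of_fine`
(19629 ⟸ F1) the `μ`-side of rung K6 on X9 reads «19630 + F1».  Nothing here decides 19630 (X9: 790 census
pairs = 130 `5Ns` + 36 `7Ns` + 624 `5S4`, `μ^an = 0` numerically at 790/790, X9-MU-TABLE v1 361f587418fce70d;
no class-wide theorem).  Beyond-print theorem: NO.  BSD is not proved by any of this.

References: K. Kato, Astérisque 295 (2004), Thm. 12.5 (4) / 12.6 (p. 222), (14.9.3) (p. 240), Thm. 17.4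
(p. 273), Prop. 17.11, §17.13 (pp. 279–280) [Kato2004Asterisque]; R. Greenberg, V. Vatsal, Invent. Math. 142
(2000) (1)–(2) and Prop. 3.7 [GreenbergVatsal2000]; R. Greenberg, LNM 1716 (1999) §5 (additivity of `μ`)
[GreenbergLNM1716]; L. Washington, GTM 83, §13.2 [Washington1997].
-/

noncomputable section

open scoped Classical MatrixGroups ModularForm NumberField
open CongruenceSubgroup WeierstrassCurve Field
open Literature.NumberTheory.GaloisRepresentations
open Literature.NumberTheory.EllipticCurves Literature.NumberTheory.EllipticCurves.ModularForms
open Literature.NumberTheory.EllipticCurves.Kato2004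
open Literature.NumberTheory.EllipticCurves.Rank1Residual (MuAnZeroAt MuAlgZeroAt FineMuZeroAt
  KatoDivisibilityAt)
open Summit.BirchSwinnertonDyer.BirchSwinnertonDyer.Rank1Residual
open Summit.BirchSwinnertonDyer.Rank1Residual.SmallImageMu (KatoDivisibilityOnClassX9
  katoDivisibilityAt_of_fineMuZeroAt_F1 fineQuotient_of_zeta)
open Summit.BirchSwinnertonDyer.BirchSwinnertonDyer.Theses.OneSidedTwistSqueezeX9 (KatoDivisibilityX9)
open Summit.BirchSwinnertonDyer.BirchSwinnertonDyer.Theses.SmallImageMuTransfer (AnalyticMuZeroX9 MuTransfer)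

namespace Summit.BirchSwinnertonDyer.BirchSwinnertonDyer.Theorems.OneSidedTwistSqueezeX9KatoDivisibilityX9OfFine

variable {W : WeierstrassCurve ℚ} [W.IsElliptic] [W.IsGloballyMinimal] {p : ℕ} [Fact p.Prime]

/-! ## §1 The quotient edge: `μ(X(E/ℚ_∞)) = 0 ⟹ μ(X₀(E/ℚ_∞)) = 0`, modulo F1 -/

/-- **The quotient edge, modulo F1** (odd good ordinary `p`, one newform `f` of `W` in hand): F1 supplies,
for every cyclotomic datum and every pair `(D, Y)` of dual Selmer / dual fine Selmer data, a SURJECTIVE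
`Λ`-linear `π : D.X ↠ Y.X` (the dual of `Sel₀ ⊆ Sel`); `D.X` is finitely generated
(`SelmerDualData.module_finite_holds`) and torsion (Kato 17.4 (1) from the package,
`Theorems.smallImageMuTransfer_kato_divisibility_of_fine`); `μ` does not increase along `π`
(`muInvariant_le_of_surjective`), so `μ(Y.X) ≤ μ(D.X) = D.mu = 0`.
[cite: Kato2004Asterisque, (14.9.3) (p. 240), Thm. 17.4 (1) (p. 273) and (17.13.1) (p. 279)]
[cite: GreenbergLNM1716, §5, Remark after Cor. 5.5 (additivity of `μ`)] -/
theorem fineMuZeroAt_of_muAlgZeroAt_of_fine (hfineZ : exists_divisibilityInputs_fineQuotient_zeta)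
    (hp2 : p ≠ 2) (hgood : W.HasGoodReductionAtPrime p) (hord : ¬ (p : ℤ) ∣ W.frobeniusTrace p)
    {N : ℕ} [NeZero N] {f : CuspForm (Gamma0 N) 2} (hf : IsNewformOf W f) (hμ : MuAlgZeroAt W p) :
    FineMuZeroAt W p := by
  intro κ γ hκ hγ hγ' Y _ _
  haveI : ContinuousSMul ℤ_[p] (W.tateModule p) := TateModule.continuousSMul_padicInt
  obtain ⟨I⟩ := nonempty_iwasawaH1Data_holds W p κ γ hκ hγ
  obtain ⟨D⟩ := W.nonempty_selmerDualData_holds κ γ hγ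
  haveI : Module.Finite (IwasawaAlgebra p) D.X := D.module_finite_holds hγ
  -- Kato 17.4 (1) at the datum, from F1: `X(E/ℚ_∞)` is `Λ`-torsion
  obtain ⟨hXt, -, -⟩ :=
    Theorems.smallImageMuTransfer_kato_divisibility_of_fine hfineZ W p (κ := κ) (γ := γ) (f := f) hp2
      ⟨hgood, hord⟩ hκ hγ hγ' hf D
  -- F1's surjection `π : X ↠ X₀` onto THIS fine datum
  obtain ⟨K, π, hπs, -⟩ := (fineQuotient_of_zeta hfineZ) W p f κ γ hp2 ⟨hgood, hord⟩ hκ hγ hγ' hf I D Y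
  have hle : muInvariant p Y.X ≤ muInvariant p D.X := muInvariant_le_of_surjective hXt π hπs
  have hD : muInvariant p D.X = 0 := hμ κ γ hκ hγ hγ' D
  omega

/-! ## §2 Per pair, CLASS-FREE: `μ(X) = 0 ⟹` Kato's integral divisibility, and `μ^an = 0 ⟹` it, modulo F1 -/

/-- **`μ(X(E/ℚ_∞)) = 0 ⟹ KatoDivisibilityAt W p`, modulo F1 ALONE** (odd good ordinary `p`, `E[p]`
irreducible) — the BCS-free twin of the landed `MuAlgZeroAt.katoDivisibilityAt` (which needs BCS (a)): the
goal's newform feeds the quotient edge, then `SmallImageMu.katoDivisibilityAt_of_fineMuZeroAt_F1`.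
[cite: Kato2004Asterisque, Thm. 17.4 (p. 273) and §17.13 (pp. 279–280)] [cite: GreenbergVatsal2000, Prop. 3.7] -/
theorem katoDivisibilityAt_of_muAlgZeroAt_of_fine (hfineZ : exists_divisibilityInputs_fineQuotient_zeta)
    (hp2 : p ≠ 2) (hgood : W.HasGoodReductionAtPrime p) (hord : ¬ (p : ℤ) ∣ W.frobeniusTrace p)
    (hirr : W.HasIrreducibleModPGaloisRep p) (hμ : MuAlgZeroAt W p) : KatoDivisibilityAt W p := by
  intro κ γ N _ f hκ hγ hγ' hf D
  exact katoDivisibilityAt_of_fineMuZeroAt_F1 (fineQuotient_of_zeta hfineZ) hp2 ⟨hgood, hord⟩ hirr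
    (fineMuZeroAt_of_muAlgZeroAt_of_fine hfineZ hp2 hgood hord hf hμ) κ γ f hκ hγ hγ' hf D

/-- **`μ^an(E, p) = 0 ⟹` Kato's integral divisibility at the pair, modulo F1 ALONE** — every `p ≥ 5` good
ordinary pair with `E[p]` irreducible (surjective, normaliser-of-Cartan, exceptional, CM alike): the
`μ`-transfer item 19629 modulo F1 (`Theorems.smallImageMuTransfer_MuTransfer_of_fine`) at the goal's newform,
then `katoDivisibilityAt_of_muAlgZeroAt_of_fine`.  No BCS 2025, no modular-parametrisation supply, no image
shape. [cite: Kato2004Asterisque, Thm. 12.6 (p. 222), §13.8, Thm. 17.4 (p. 273) and §17.13 (pp. 279–280)]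
[cite: GreenbergVatsal2000, Prop. 3.7] -/
theorem katoDivisibilityAt_of_muAnZeroAt_F1 (hfineZ : exists_divisibilityInputs_fineQuotient_zeta)
    (hp : 5 ≤ p) (hgood : W.HasGoodReductionAtPrime p) (hord : ¬ (p : ℤ) ∣ W.frobeniusTrace p)
    (hirr : W.HasIrreducibleModPGaloisRep p) (hAn : MuAnZeroAt W p) : KatoDivisibilityAt W p := by
  intro κ γ N _ f hκ hγ hγ' hf D
  have hT : KatoMuTransfer := Theorems.smallImageMuTransfer_MuTransfer_of_fine hfineZ
  have hμ : MuAlgZeroAt W p := fun κ₁ γ₁ hκ₁ hγ₁ hγ₁' D₁ =>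
    hT W p f hp hgood hord hirr hf (hAn f hf) κ₁ γ₁ hκ₁ hγ₁ hγ₁' D₁
  exact katoDivisibilityAt_of_muAlgZeroAt_of_fine hfineZ (by omega) hgood hord hirr hμ κ γ f hκ hγ hγ' hf D

/-! ## §3 The class node: crux 20547 from crux 19630, modulo F1 ALONE -/

/-- **W-58 (iv): `KatoDivisibilityX9 ⟸ AnalyticMuZeroX9`, modulo the single published construction fact F1**
(`Kato2004.exists_divisibilityInputs_fineQuotient_zeta`) — NO modularity binder, NO Burungale–Castella–Skinner:
per X9 pair by `katoDivisibilityAt_of_muAnZeroAt_F1` at the goal's own newform (the class predicate contributes only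
`5 ≤ p`, good ordinary, `Irr(E[p])`; both nodes unfolded by `rfl`, no transport lemma).
[cite: Kato2004Asterisque, Thm. 12.6 (p. 222), Thm. 17.4 (p. 273) and §17.13 (pp. 279–280)]
[cite: GreenbergVatsal2000, Prop. 3.7] -/
theorem katoDivisibilityX9_of_analyticMuZeroX9_of_fine
    (hfineZ : exists_divisibilityInputs_fineQuotient_zeta) (hA : AnalyticMuZeroX9) : KatoDivisibilityX9 := by
  intro W _ _ p _ κ γ N _ f hX9 hκ hγ hγ' hf D
  obtain ⟨-, hp, hgood, hord, hirr, -⟩ := id hX9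
  have hAn : MuAnZeroAt W p := fun g hg => hA W p g hX9 hg
  exact katoDivisibilityAt_of_muAnZeroAt_F1 hfineZ hp hgood hord hirr hAn κ γ f hκ hγ hγ' hf D

/-! ## §4 The same modulo F1′ (the print cell's verbatim-composite restatement of F1) — one-term ports -/

/-- **Per pair modulo F1′**: `μ^an(E, p) = 0 ⟹` Kato's integral divisibility at every `p ≥ 5` good ordinary
pair with `E[p]` irreducible, keyed on `Kato2004.exists_divisibilityInputsZetaLine_fineQuotient_zeta` through the
landed port `exists_divisibilityInputs_fineQuotient_zeta_of_zetaLine`.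
[cite: Kato2004Asterisque, Thm. 12.6 (p. 222), Thm. 16.6 (2), Prop. 17.11 (p. 277), Thm. 17.4 (p. 273) and §17.13 (pp. 279–280)] -/
theorem katoDivisibilityAt_of_muAnZeroAt_zetaLine
    (hzeta : exists_divisibilityInputsZetaLine_fineQuotient_zeta)
    (hp : 5 ≤ p) (hgood : W.HasGoodReductionAtPrime p) (hord : ¬ (p : ℤ) ∣ W.frobeniusTrace p)
    (hirr : W.HasIrreducibleModPGaloisRep p) (hAn : MuAnZeroAt W p) : KatoDivisibilityAt W p :=
  katoDivisibilityAt_of_muAnZeroAt_F1 (exists_divisibilityInputs_fineQuotient_zeta_of_zetaLine hzeta)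
    hp hgood hord hirr hAn

/-- **W-58 (iv) modulo F1′**: `KatoDivisibilityX9 ⟸ AnalyticMuZeroX9` keyed on the verbatim-composite fact
`Kato2004.exists_divisibilityInputsZetaLine_fineQuotient_zeta` (no Irr-only clause, no modularity, no BCS).
[cite: Kato2004Asterisque, Thm. 12.6 (p. 222), Thm. 16.6 (2), Prop. 17.11 (p. 277), Thm. 17.4 (p. 273) and §17.13 (pp. 279–280)] -/
theorem katoDivisibilityX9_of_analyticMuZeroX9_of_zetaLine
    (hzeta : exists_divisibilityInputsZetaLine_fineQuotient_zeta) (hA : AnalyticMuZeroX9) :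
    KatoDivisibilityX9 := by
  intro W _ _ p _ κ γ N _ f hX9 hκ hγ hγ' hf D
  obtain ⟨-, hp, hgood, hord, hirr, -⟩ := id hX9
  have hAn : MuAnZeroAt W p := fun g hg => hA W p g hX9 hg
  exact katoDivisibilityAt_of_muAnZeroAt_zetaLine hzeta hp hgood hord hirr hAn κ γ f hκ hγ hγ' hf D

/-- Sanity: the two route decls are the cell's tree nodes. -/
example : KatoDivisibilityX9 = KatoDivisibilityOnClassX9 := rfl
example : AnalyticMuZeroX9 = AnalyticMuZeroOnClassX9 := rfl

end Summit.BirchSwinnertonDyer.BirchSwinnertonDyer.Theorems.OneSidedTwistSqueezeX9KatoDivisibilityX9OfFine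

end
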